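import Literature.Combinatorics.SimpleGraph.HamiltonianGadgetSubstitutionRefined
import Literature.Combinatorics.SimpleGraph.HamiltonianTwoSlotGadgets
import Literature.Combinatorics.SimpleGraph.HamiltonianPathEnumeration
import Literature.Combinatorics.SimpleGraph.HamiltonianGadgetTransport
import Literature.Combinatorics.SimpleGraph.HamiltonianRailGadget
import Mathlib.Tactic.FinCases
import HarnessLib

/-!
# The diamond ladder: Garey–Johnson–Tarjan's crossable exclusive-or line, and its census

The exclusive-or gadget of Garey–Johnson–Tarjan 1976 is a ladder whose two rails subdivide the two
edges `e`, `f` it joins; "to go through all the nodes … one has to enter and exit on the same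
vertical axis" (Liśkiewicz–Ogihara–Toda 2003, §3). To let a second exclusive-or line CROSS it
(LOT2003, Fig. 2 (b), read off the report version ECCC TR01-061 rev. 2, p. 8), every rung is
routed through a two-node cycle; the crossing line is then cut into exclusive-or gadgets chained
through these cycles (`XOR(g, top₁), XOR(bot₁, top₂), …, XOR(bot₄, h)`: "four XOR-gadgets are
added"). In the simple graphs of maximum degree three used here the two-node cycle on a rung is
the **diamond** `p a b q` (`p a, p b, a b, a q, b q`; the cell of `HamiltonianDiamondChain.lean`):
the rung enters at `p` and leaves at `q`, through `a b` or through `b a`, and the crossing line's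
gadgets are substituted into the **hop edges** `p a` ("state A") and `p b` ("state B").

* `DiamondLadder.graph : SimpleGraph (Fin 28)` — rails `v₀…v₃ = 0…3` (ports `24 ~ v₀`, `25 ~ v₃`:
  slot `e = (24, 25)`), `w₀…w₃ = 4…7` (ports `26, 27`: slot `f = (26, 27)`), rung `k` =
  `vₖ – pₖ`, diamond `pₖ aₖ bₖ qₖ = 8+4k … 11+4k`, `qₖ – wₖ`; `VX` = the 24 inner vertices;
  hop edges `UL k = (pₖ, aₖ)`, `LL k = (pₖ, bₖ)`, `H` = all eight;
* **census** (`coverCount_e`, `coverCount_f`, `coverCount_ef`, `coverCount_none`): `16, 16, 0, 0`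
  — traversed from the `e` side or from the `f` side, each of the four diamonds in either state;
* **refined census** (`coverCountRF_e`, `coverCountRF_f`): with every hop edge required or
  forbidden, exactly one cover iff each diamond has exactly one of its two hop edges required
  (`Consistent`), none otherwise — the table through which the chained exclusive-or gadgets of
  the crossing line see the diamonds, and nothing of `e`/`f`;
* **exclusivity** (`exclusive`), by `exclusive_pair_of_hamCount_eq_zero`
  (`HamiltonianTwoSlotGadgets`-style certification: wrong port pairs and the two connector graphs
  admit no Hamiltonian path; kernel evaluation of the verified enumerator).

Also proved here (generic): `coverCountRF_singleton_eq_hamCountRF`, the refined census of a single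
realised slot as a constrained Hamiltonian-path count.

## References

* M. R. Garey, D. S. Johnson, R. E. Tarjan, *The planar Hamiltonian circuit problem is
  NP-complete*, SIAM J. Comput. 5 (1976) 704–714, §2 (exclusive-or, crossing of exclusive-or lines).
* M. Liśkiewicz, M. Ogihara, S. Toda, TCS 304 (2003) 129–156, §3, Fig. 2 (report: ECCC TR01-061).
-/

namespace Literature.Combinatorics.SimpleGraph

/-! ### The refined census of one realised slot -/

section generic

variable {α : Type*} [DecidableEq α] {GX : _root_.SimpleGraph α} {VX : Finset α}

omit [DecidableEq α] in
/-- A consecutive pair of `a, L, b` avoiding `a` on the left and `b` on the right lies in `L`. [folklore] -/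
theorem pair_infix_of_cons_append_singleton {a b x y : α} {L : List α} (h : [x, y] <:+: a :: (L ++ [b]))
    (hx : x ≠ a) (hy : y ≠ b) : [x, y] <:+: L := by
  rw [List.infix_cons_iff] at h
  rcases h with h | h
  · rw [List.cons_prefix_cons] at h
    exact absurd h.1 hx
  · rcases pair_infix_append h with h | h | ⟨-, h2⟩
    · exact h
    · have := h.length_le
      simp only [List.length_cons, List.length_nil] at this
      omega
    · simp only [List.head?_cons, Option.some.injEq] at h2
      exact absurd h2.symm hy

omit [DecidableEq α] in
/-- Used inner edges of `a, L, b` are used edges of `L`. [folklore] -/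
theorem uses_cons_append_singleton_iff {a b : α} {L : List α} {x : α × α}
    (h1a : x.1 ≠ a) (h1b : x.1 ≠ b) (h2a : x.2 ≠ a) (h2b : x.2 ≠ b) :
    Uses (a :: (L ++ [b])) x ↔ Uses L x := by
  constructor
  · rintro (h | h)
    · exact Or.inl (pair_infix_of_cons_append_singleton h h1a h2b)
    · exact Or.inr (pair_infix_of_cons_append_singleton h h2a h1b)
  · rintro (⟨s, t, hst⟩ | ⟨s, t, hst⟩)
    · exact Or.inl ⟨a :: s, t ++ [b], by rw [← hst]; simp⟩
    · exact Or.inr ⟨a :: s, t ++ [b], by rw [← hst]; simp⟩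

/-- **The refined census of a single slot `(a, b)` is the number of Hamiltonian `a`–`b` paths of
the gadget through `VX ∪ {a, b}` using `RX` and avoiding `FX`** (inner edges).
[cite: GareyJohnson1979, §3.2.2] -/
theorem coverCountRF_singleton_eq_hamCountRF (hVX : VX.Nonempty) {a b : α} (ha : a ∉ VX) (hb : b ∉ VX)
    (hab : a ≠ b) {RX FX : Finset (α × α)} (hRX : ∀ x ∈ RX, x.1 ∈ VX ∧ x.2 ∈ VX)
    (hFX : ∀ x ∈ FX, x.1 ∈ VX ∧ x.2 ∈ VX) :
    coverCountRF GX VX {(a, b)} RX FX = hamCountRF GX (insert a (insert b VX)) a b RX FX := by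
  set φ : (α × α → List α) → List α := fun f => a :: (f (a, b) ++ [b]) with hφ
  have hW : ∀ x, x ∈ insert a (insert b VX) ↔ x = a ∨ x = b ∨ x ∈ VX := fun x => by simp
  have hcov_of : ∀ f, IsCover GX VX {(a, b)} f → ∀ x ∈ VX, x ∈ f (a, b) := fun f hf x hx => by
    obtain ⟨e, he, hxe⟩ := hf.2.2.2 x hx
    rw [Finset.mem_singleton] at he
    exact he ▸ hxe
  -- inner edges: used by the glued path iff used by the strand
  have huses : ∀ (L : List α) (x : α × α), x.1 ∈ VX → x.2 ∈ VX → (Uses (a :: (L ++ [b])) x ↔ Uses L x) :=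
    fun L x h1 h2 => uses_cons_append_singleton_iff (fun h => ha (h ▸ h1)) (fun h => hb (h ▸ h1))
      (fun h => ha (h ▸ h2)) (fun h => hb (h ▸ h2))
  have husesF : ∀ (f : α × α → List α) (x : α × α), UsesF f {(a, b)} x ↔ Uses (f (a, b)) x := fun f x => by
    constructor
    · rintro ⟨e, he, hu⟩
      rw [Finset.mem_singleton] at he
      exact he ▸ hu
    · exact fun hu => ⟨(a, b), Finset.mem_singleton_self _, hu⟩
  have himg : φ '' coverSetRF GX VX {(a, b)} RX FX = hamSetRF GX (insert a (insert b VX)) a b RX FX := by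
    ext l
    simp only [Set.mem_image]
    constructor
    · rintro ⟨f, ⟨hf, hR, hF⟩, rfl⟩
      refine ⟨isHamPathOn_strand (hf.1 _ (Finset.mem_singleton_self _)) (hcov_of f hf) ha hb hab hW,
        fun x hx => ?_, fun x hx => ?_⟩
      · exact (huses _ x (hRX x hx).1 (hRX x hx).2).2 ((husesF f x).1 (hR x hx))
      · exact fun hu => hF x hx ((husesF f x).2 ((huses _ x (hFX x hx).1 (hFX x hx).2).1 hu))
    · rintro ⟨hl, hR, hF⟩
      obtain ⟨hnd, hsupp, hhead, hlast, hch⟩ := hl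
      obtain ⟨L, rfl⟩ := exists_eq_cons_append_of_head?_getLast? hhead hlast hab
      have hLsub : ∀ x ∈ L, x ∈ VX := fun x hx => by
        have hx' : x ∈ insert a (insert b VX) := by
          rw [← hsupp]; simp [hx]
        rw [Finset.mem_insert, Finset.mem_insert] at hx'
        rcases hx' with h | h | h
        · subst h
          exact absurd (List.mem_append_left [b] hx) (List.nodup_cons.1 hnd).1
        · subst h
          exact absurd (List.mem_singleton_self x) (List.disjoint_of_nodup_append (List.nodup_cons.1 hnd).2 hx)
        · exact h
      have hLcov : ∀ x ∈ VX, x ∈ L := fun x hx => by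
        have hx' : x ∈ a :: (L ++ [b]) := by
          rw [← List.mem_toFinset, hsupp]; simp [hx]
        simp only [List.mem_cons, List.mem_append, List.mem_nil_iff, or_false] at hx'
        rcases hx' with rfl | h | rfl
        · exact absurd hx ha
        · exact h
        · exact absurd hx hb
      have hLne : L ≠ [] := by
        obtain ⟨x, hx⟩ := hVX
        exact List.ne_nil_of_mem (hLcov x hx)
      set f : α × α → List α := fun e => if e = (a, b) then L else [] with hf
      have hfab : f (a, b) = L := by simp [hf]
      have hcover : IsCover GX VX {(a, b)} f := by
        refine ⟨fun e he => ?_, fun e he => ?_, ?_, fun x hx => ?_⟩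
        · rw [Finset.mem_singleton] at he
          subst he
          rw [hfab]
          exact ⟨hLne, hLsub, (List.nodup_append.1 (List.nodup_cons.1 hnd).2).1, hch⟩
        · rw [Finset.mem_singleton] at he
          simp [hf, he]
        · intro e he e' he' hne
          rw [Finset.mem_singleton] at he he'
          exact absurd (he.trans he'.symm) hne
        · exact ⟨(a, b), Finset.mem_singleton_self _, by rw [hfab]; exact hLcov x hx⟩
      refine ⟨f, ⟨hcover, fun x hx => ?_, fun x hx hu => ?_⟩, by simp [hφ, hfab]⟩
      · rw [husesF, hfab]
        exact (huses L x (hRX x hx).1 (hRX x hx).2).1 (hR x hx)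
      · rw [husesF, hfab] at hu
        exact hF x hx ((huses L x (hFX x hx).1 (hFX x hx).2).2 hu)
  have hinj : Set.InjOn φ (coverSetRF GX VX {(a, b)} RX FX) := by
    intro f hf f' hf' heq
    simp only [hφ, List.cons.injEq, true_and] at heq
    have hab' : f (a, b) = f' (a, b) := List.append_cancel_right heq
    funext e
    by_cases he : e = (a, b)
    · rw [he, hab']
    · rw [hf.1.2.1 e (by simpa using he), hf'.1.2.1 e (by simpa using he)]
  rw [coverCountRF, ← hinj.ncard_image, himg, hamCountRF]

end generic

/-! ### The template -/

namespace DiamondLadder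

/-- The edges: rails `0–1–2–3`, `4–5–6–7`; rung `k` = `k – pₖ`, diamond `pₖ aₖ bₖ qₖ`
(`8+4k, 9+4k, 10+4k, 11+4k`), `qₖ – (4+k)`; port edges `24–0`, `25–3`, `26–4`, `27–7`.
[cite: LiskiewiczOgiharaToda2003, §3, Fig. 2 (b)] -/
def edges : List (Fin 28 × Fin 28) :=
  [(0, 1), (1, 2), (2, 3), (4, 5), (5, 6), (6, 7), (0, 8), (8, 9), (8, 10), (9, 10), (9, 11), (10, 11), (11, 4), (1, 12), (12, 13), (12, 14), (13, 14), (13, 15), (14, 15), (15, 5), (2, 16), (16, 17), (16, 18), (17, 18), (17, 19), (18, 19), (19, 6), (3, 20), (20, 21), (20, 22), (21, 22), (21, 23), (22, 23), (23, 7), (24, 0), (25, 3), (26, 4), (27, 7)]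

/-- Neighbours read off the edge list. [folklore] -/
def nbrs (x : Fin 28) : List (Fin 28) :=
  edges.filterMap fun e => if e.1 = x then some e.2 else if e.2 = x then some e.1 else none

/-- Boolean adjacency. [folklore] -/
def adj (x y : Fin 28) : Bool :=
  decide (y ∈ nbrs x)

/-- The adjacency is symmetric (by `decide`). [folklore] -/
theorem adj_symm (x y : Fin 28) : adj x y = adj y x := by
  revert x y; decide +kernel

/-- The adjacency is irreflexive (by `decide`). [folklore] -/
theorem adj_irrefl (x : Fin 28) : adj x x = false := by
  revert x; decide +kernel

/-- **The diamond ladder** as a simple graph on `Fin 28`. [cite: LiskiewiczOgiharaToda2003, §3, Fig. 2 (b)] -/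
def graph : _root_.SimpleGraph (Fin 28) where
  Adj x y := adj x y = true
  symm := ⟨fun x y h => by rw [adj_symm]; exact h⟩
  loopless := ⟨fun x h => by rw [adj_irrefl] at h; exact Bool.false_ne_true h⟩

/-- Adjacency of `graph` is decidable. [folklore] -/
instance : DecidableRel graph.Adj := fun x y => inferInstanceAs (Decidable (adj x y = true))

/-- Adjacency of `graph` is `adj` (by definition). [folklore] -/
theorem graph_adj (x y : Fin 28) : graph.Adj x y ↔ adj x y = true := Iff.rfl

/-- The inner vertices `0, …, 23`. [folklore] -/
def VX : Finset (Fin 28) := Finset.univ.filter fun x => x.val < 24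

/-- The slot `e` (ports at the ends of the rail `0–3`). [folklore] -/
def se : Fin 28 × Fin 28 := (24, 25)

/-- The slot `f` (ports at the ends of the rail `4–7`). [folklore] -/
def sf : Fin 28 × Fin 28 := (26, 27)

/-- The two slots. [folklore] -/
def slots : Finset (Fin 28 × Fin 28) := {se, sf}

/-- The hop edge `pₖ aₖ` of diamond `k` (used in state A). [cite: LiskiewiczOgiharaToda2003, §3, Fig. 2 (b) ("top")] -/
def UL (k : Fin 4) : Fin 28 × Fin 28 := (⟨8 + 4 * k.val, by omega⟩, ⟨9 + 4 * k.val, by omega⟩)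

/-- The hop edge `pₖ bₖ` of diamond `k` (used in state B). [cite: LiskiewiczOgiharaToda2003, §3, Fig. 2 (b) ("bot")] -/
def LL (k : Fin 4) : Fin 28 × Fin 28 := (⟨8 + 4 * k.val, by omega⟩, ⟨10 + 4 * k.val, by omega⟩)

/-- All eight hop edges. [folklore] -/
def H : Finset (Fin 28 × Fin 28) := Finset.univ.image UL ∪ Finset.univ.image LL

/-- **Consistency of a set of required hop edges**: each diamond has exactly one of its two hop
edges in the set. [folklore] -/
def Consistent (RX : Finset (Fin 28 × Fin 28)) : Prop :=
  ∀ k : Fin 4, UL k ∈ RX ↔ LL k ∉ RX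

/-! ### Enumerations (kernel computation) -/

/-- The vertex list for covers realising `e`: inner vertices and the ports of `e`. [folklore] -/
def vsE : List (Fin 28) := (List.finRange 28).filter fun x => x.val < 24 ∨ x.val = 24 ∨ x.val = 25

/-- The vertex list for covers realising `f`. [folklore] -/
def vsF : List (Fin 28) := (List.finRange 28).filter fun x => x.val < 24 ∨ x.val = 26 ∨ x.val = 27

/-- **The sixteen traversals from the `e` side** (zigzag `24, v₀, rung 0, w₀, w₁, rung 1, v₁, v₂,
rung 2, w₂, w₃, rung 3, v₃, 25`, each diamond as `p a b q` or `p b a q`), by kernel evaluation of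
the verified enumerator. [cite: LiskiewiczOgiharaToda2003, §3 ("for each of the two vertical axes …")] -/
theorem hamPathsList_e : hamPathsList adj vsE 24 25 =
  [[24, 0, 8, 9, 10, 11, 4, 5, 15, 13, 14, 12, 1, 2, 16, 17, 18, 19, 6, 7, 23, 21, 22, 20, 3, 25],
   [24, 0, 8, 9, 10, 11, 4, 5, 15, 13, 14, 12, 1, 2, 16, 17, 18, 19, 6, 7, 23, 22, 21, 20, 3, 25],
   [24, 0, 8, 9, 10, 11, 4, 5, 15, 13, 14, 12, 1, 2, 16, 18, 17, 19, 6, 7, 23, 21, 22, 20, 3, 25],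
   [24, 0, 8, 9, 10, 11, 4, 5, 15, 13, 14, 12, 1, 2, 16, 18, 17, 19, 6, 7, 23, 22, 21, 20, 3, 25],
   [24, 0, 8, 9, 10, 11, 4, 5, 15, 14, 13, 12, 1, 2, 16, 17, 18, 19, 6, 7, 23, 21, 22, 20, 3, 25],
   [24, 0, 8, 9, 10, 11, 4, 5, 15, 14, 13, 12, 1, 2, 16, 17, 18, 19, 6, 7, 23, 22, 21, 20, 3, 25],
   [24, 0, 8, 9, 10, 11, 4, 5, 15, 14, 13, 12, 1, 2, 16, 18, 17, 19, 6, 7, 23, 21, 22, 20, 3, 25],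
   [24, 0, 8, 9, 10, 11, 4, 5, 15, 14, 13, 12, 1, 2, 16, 18, 17, 19, 6, 7, 23, 22, 21, 20, 3, 25],
   [24, 0, 8, 10, 9, 11, 4, 5, 15, 13, 14, 12, 1, 2, 16, 17, 18, 19, 6, 7, 23, 21, 22, 20, 3, 25],
   [24, 0, 8, 10, 9, 11, 4, 5, 15, 13, 14, 12, 1, 2, 16, 17, 18, 19, 6, 7, 23, 22, 21, 20, 3, 25],
   [24, 0, 8, 10, 9, 11, 4, 5, 15, 13, 14, 12, 1, 2, 16, 18, 17, 19, 6, 7, 23, 21, 22, 20, 3, 25],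
   [24, 0, 8, 10, 9, 11, 4, 5, 15, 13, 14, 12, 1, 2, 16, 18, 17, 19, 6, 7, 23, 22, 21, 20, 3, 25],
   [24, 0, 8, 10, 9, 11, 4, 5, 15, 14, 13, 12, 1, 2, 16, 17, 18, 19, 6, 7, 23, 21, 22, 20, 3, 25],
   [24, 0, 8, 10, 9, 11, 4, 5, 15, 14, 13, 12, 1, 2, 16, 17, 18, 19, 6, 7, 23, 22, 21, 20, 3, 25],
   [24, 0, 8, 10, 9, 11, 4, 5, 15, 14, 13, 12, 1, 2, 16, 18, 17, 19, 6, 7, 23, 21, 22, 20, 3, 25],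
   [24, 0, 8, 10, 9, 11, 4, 5, 15, 14, 13, 12, 1, 2, 16, 18, 17, 19, 6, 7, 23, 22, 21, 20, 3, 25]] := by
  decide +kernel

/-- **The sixteen traversals from the `f` side.** [cite: LiskiewiczOgiharaToda2003, §3] -/
theorem hamPathsList_f : hamPathsList adj vsF 26 27 =
  [[26, 4, 11, 9, 10, 8, 0, 1, 12, 13, 14, 15, 5, 6, 19, 17, 18, 16, 2, 3, 20, 21, 22, 23, 7, 27],
   [26, 4, 11, 9, 10, 8, 0, 1, 12, 13, 14, 15, 5, 6, 19, 17, 18, 16, 2, 3, 20, 22, 21, 23, 7, 27],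
   [26, 4, 11, 9, 10, 8, 0, 1, 12, 13, 14, 15, 5, 6, 19, 18, 17, 16, 2, 3, 20, 21, 22, 23, 7, 27],
   [26, 4, 11, 9, 10, 8, 0, 1, 12, 13, 14, 15, 5, 6, 19, 18, 17, 16, 2, 3, 20, 22, 21, 23, 7, 27],
   [26, 4, 11, 9, 10, 8, 0, 1, 12, 14, 13, 15, 5, 6, 19, 17, 18, 16, 2, 3, 20, 21, 22, 23, 7, 27],
   [26, 4, 11, 9, 10, 8, 0, 1, 12, 14, 13, 15, 5, 6, 19, 17, 18, 16, 2, 3, 20, 22, 21, 23, 7, 27],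
   [26, 4, 11, 9, 10, 8, 0, 1, 12, 14, 13, 15, 5, 6, 19, 18, 17, 16, 2, 3, 20, 21, 22, 23, 7, 27],
   [26, 4, 11, 9, 10, 8, 0, 1, 12, 14, 13, 15, 5, 6, 19, 18, 17, 16, 2, 3, 20, 22, 21, 23, 7, 27],
   [26, 4, 11, 10, 9, 8, 0, 1, 12, 13, 14, 15, 5, 6, 19, 17, 18, 16, 2, 3, 20, 21, 22, 23, 7, 27],
   [26, 4, 11, 10, 9, 8, 0, 1, 12, 13, 14, 15, 5, 6, 19, 17, 18, 16, 2, 3, 20, 22, 21, 23, 7, 27],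
   [26, 4, 11, 10, 9, 8, 0, 1, 12, 13, 14, 15, 5, 6, 19, 18, 17, 16, 2, 3, 20, 21, 22, 23, 7, 27],
   [26, 4, 11, 10, 9, 8, 0, 1, 12, 13, 14, 15, 5, 6, 19, 18, 17, 16, 2, 3, 20, 22, 21, 23, 7, 27],
   [26, 4, 11, 10, 9, 8, 0, 1, 12, 14, 13, 15, 5, 6, 19, 17, 18, 16, 2, 3, 20, 21, 22, 23, 7, 27],
   [26, 4, 11, 10, 9, 8, 0, 1, 12, 14, 13, 15, 5, 6, 19, 17, 18, 16, 2, 3, 20, 22, 21, 23, 7, 27],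
   [26, 4, 11, 10, 9, 8, 0, 1, 12, 14, 13, 15, 5, 6, 19, 18, 17, 16, 2, 3, 20, 21, 22, 23, 7, 27],
   [26, 4, 11, 10, 9, 8, 0, 1, 12, 14, 13, 15, 5, 6, 19, 18, 17, 16, 2, 3, 20, 22, 21, 23, 7, 27]] := by
  decide +kernel

/-! ### Bookkeeping facts (by `decide`) -/

/-- `vsE` has distinct entries. [folklore] -/
theorem nodup_vsE : vsE.Nodup := by decide

/-- `vsF` has distinct entries. [folklore] -/
theorem nodup_vsF : vsF.Nodup := by decide

/-- `vsE` lists `VX ∪ {24, 25}`. [folklore] -/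
theorem toFinset_vsE : vsE.toFinset = insert (24 : Fin 28) (insert 25 VX) :=
  Finset.ext fun x => by revert x; decide

/-- `vsF` lists `VX ∪ {26, 27}`. [folklore] -/
theorem toFinset_vsF : vsF.toFinset = insert (26 : Fin 28) (insert 27 VX) :=
  Finset.ext fun x => by revert x; decide

/-- The inner vertex set is nonempty. [folklore] -/
theorem VX_nonempty : VX.Nonempty := ⟨0, by decide⟩

/-- Membership in `H`. [folklore] -/
theorem mem_H_iff {x : Fin 28 × Fin 28} : x ∈ H ↔ ∃ k, x = UL k ∨ x = LL k := by
  simp only [H, Finset.mem_union, Finset.mem_image, Finset.mem_univ, true_and]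
  constructor
  · rintro (⟨k, hk⟩ | ⟨k, hk⟩)
    exacts [⟨k, Or.inl hk.symm⟩, ⟨k, Or.inr hk.symm⟩]
  · rintro ⟨k, hk | hk⟩
    exacts [Or.inl ⟨k, hk.symm⟩, Or.inr ⟨k, hk.symm⟩]

/-- The hop edges are inner edges. [folklore] -/
theorem H_inner : ∀ x ∈ H, x.1 ∈ VX ∧ x.2 ∈ VX := by
  intro x hx
  obtain ⟨k, rfl | rfl⟩ := mem_H_iff.1 hx
  · simp only [UL, VX, Finset.mem_filter, Finset.mem_univ, true_and]
    have := k.isLt; omega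
  · simp only [LL, VX, Finset.mem_filter, Finset.mem_univ, true_and]
    have := k.isLt; omega

/-- Consistency is decidable. [folklore] -/
instance (RX : Finset (Fin 28 × Fin 28)) : Decidable (Consistent RX) := by
  unfold Consistent; infer_instance

/-! ### The census: sixteen traversals from each side, none through both, none through neither -/

/-- **`N{e} = 16`**: traversed from the `e` side, each of the four diamonds in either state.
[cite: LiskiewiczOgiharaToda2003, §3, Fig. 2 (b)] -/
theorem coverCount_e : coverCount graph VX {se} = 16 := by
  rw [se, coverCount_singleton_eq_hamCount VX_nonempty (by decide) (by decide) (by decide), ← toFinset_vsE,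
    hamCount_eq_length_hamPathsList graph adj vsE nodup_vsE (fun _ _ _ _ => Iff.rfl), hamPathsList_e]
  rfl

/-- **`N{f} = 16`.** [cite: LiskiewiczOgiharaToda2003, §3, Fig. 2 (b)] -/
theorem coverCount_f : coverCount graph VX {sf} = 16 := by
  rw [sf, coverCount_singleton_eq_hamCount VX_nonempty (by decide) (by decide) (by decide), ← toFinset_vsF,
    hamCount_eq_length_hamPathsList graph adj vsF nodup_vsF (fun _ _ _ _ => Iff.rfl), hamPathsList_f]
  rfl

/-- **`N∅ = 0`.** [folklore] -/
theorem coverCount_none : coverCount graph VX (∅ : Finset (Fin 28 × Fin 28)) = 0 :=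
  coverCount_empty_eq_zero VX_nonempty

/-- Boolean adjacency of the connector graph `graph ⊔ edge u v`. [folklore] -/
def adjWith (u v : Fin 28) (x y : Fin 28) : Bool :=
  adj x y || ((x = u ∧ y = v) ∨ (x = v ∧ y = u)) && (x ≠ y)

/-- The connector graph's adjacency is `adjWith`. [folklore] -/
theorem adjWith_iff (u v : Fin 28) (x y : Fin 28) :
    (graph ⊔ _root_.SimpleGraph.fromEdgeSet {s(u, v)}).Adj x y ↔ adjWith u v x y = true := by
  rw [_root_.SimpleGraph.sup_adj, _root_.SimpleGraph.fromEdgeSet_adj, Set.mem_singleton_iff, Sym2.eq_iff, graph_adj,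
    adjWith]
  simp only [Bool.or_eq_true, Bool.and_eq_true, decide_eq_true_eq, ne_eq]

/-- All vertices, listed. [folklore] -/
def vsAll : List (Fin 28) := List.finRange 28

/-- **No cover realises both slots** — the connector graph `graph ⊔ edge 25 26` has no Hamiltonian
`24`–`27` path (kernel computation). [cite: LiskiewiczOgiharaToda2003, §3 (XOR-gadget)] -/
theorem hamCount_connA :
    hamCount (graph ⊔ _root_.SimpleGraph.fromEdgeSet {s((25 : Fin 28), (26 : Fin 28))}) Finset.univ 24 27 = 0 := by
  rw [hamCount_univ_eq_length_hamPathsList _ (adjWith 25 26) vsAll (List.nodup_finRange 28) List.mem_finRange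
    (fun a b => adjWith_iff 25 26 a b)]
  decide +kernel

/-- The second connector graph `graph ⊔ edge 25 27` has no Hamiltonian `24`–`26` path (kernel
computation). [cite: LiskiewiczOgiharaToda2003, §3 (XOR-gadget)] -/
theorem hamCount_connB :
    hamCount (graph ⊔ _root_.SimpleGraph.fromEdgeSet {s((25 : Fin 28), (27 : Fin 28))}) Finset.univ 24 26 = 0 := by
  rw [hamCount_univ_eq_length_hamPathsList _ (adjWith 25 27) vsAll (List.nodup_finRange 28) List.mem_finRange
    (fun a b => adjWith_iff 25 27 a b)]
  decide +kernel

/-- Connector graphs with the connector written the other way round. [folklore] -/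
theorem fromEdgeSet_pair_comm (u v : Fin 28) :
    _root_.SimpleGraph.fromEdgeSet ({s(u, v)} : Set (Sym2 (Fin 28))) = _root_.SimpleGraph.fromEdgeSet {s(v, u)} := by
  rw [Sym2.eq_swap]

/-- The vertex set `VX ∪ ports` is everything. [folklore] -/
theorem mem_univ_iff_ports (x : Fin 28) :
    x ∈ (Finset.univ : Finset (Fin 28)) ↔ x = se.1 ∨ x = se.2 ∨ x = sf.1 ∨ x = sf.2 ∨ x ∈ VX := by
  simp only [Finset.mem_univ, true_iff, se, sf]
  revert x; decide

/-- **`N{e, f} = 0`**: no cover uses both axes. [cite: LiskiewiczOgiharaToda2003, §3 (XOR-gadget)] -/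
theorem coverCount_ef : coverCount graph VX slots = 0 := by
  rw [slots]
  refine coverCount_pair_eq_zero_of_hamCount_eq_zero (e := se) (f := sf) (by decide)
    (by decide) (by decide) (by decide) (by decide) (by decide) (by decide) (by decide) (by decide) (by decide) (by decide)
    (W := Finset.univ) mem_univ_iff_ports ?_
  exact hamCount_connA

/-! ### Wrong port pairs admit no traversal; exclusivity -/

/-- Vertex list `VX ∪ {p, q}`. [folklore] -/
def vsPair (p q : Fin 28) : List (Fin 28) := (List.finRange 28).filter fun x => x.val < 24 ∨ x = p ∨ x = q

/-- No traversal between the wrong ports `24, 26` (kernel computation). [cite: LiskiewiczOgiharaToda2003, §3] -/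
theorem hamCount_24_26 : hamCount graph (insert (24 : Fin 28) (insert 26 VX)) 24 26 = 0 := by
  rw [show insert (24 : Fin 28) (insert 26 VX) = (vsPair 24 26).toFinset from Finset.ext fun x => by revert x; decide,
    hamCount_eq_length_hamPathsList graph adj (vsPair 24 26) (by decide) (fun _ _ _ _ => Iff.rfl)]
  decide +kernel

/-- No traversal between the wrong ports `24, 27` (kernel computation). [cite: LiskiewiczOgiharaToda2003, §3] -/
theorem hamCount_24_27 : hamCount graph (insert (24 : Fin 28) (insert 27 VX)) 24 27 = 0 := by
  rw [show insert (24 : Fin 28) (insert 27 VX) = (vsPair 24 27).toFinset from Finset.ext fun x => by revert x; decide,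
    hamCount_eq_length_hamPathsList graph adj (vsPair 24 27) (by decide) (fun _ _ _ _ => Iff.rfl)]
  decide +kernel

/-- No traversal between the wrong ports `25, 26` (kernel computation). [cite: LiskiewiczOgiharaToda2003, §3] -/
theorem hamCount_25_26 : hamCount graph (insert (25 : Fin 28) (insert 26 VX)) 25 26 = 0 := by
  rw [show insert (25 : Fin 28) (insert 26 VX) = (vsPair 25 26).toFinset from Finset.ext fun x => by revert x; decide,
    hamCount_eq_length_hamPathsList graph adj (vsPair 25 26) (by decide) (fun _ _ _ _ => Iff.rfl)]
  decide +kernel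

/-- No traversal between the wrong ports `25, 27` (kernel computation). [cite: LiskiewiczOgiharaToda2003, §3] -/
theorem hamCount_25_27 : hamCount graph (insert (25 : Fin 28) (insert 27 VX)) 25 27 = 0 := by
  rw [show insert (25 : Fin 28) (insert 27 VX) = (vsPair 25 27).toFinset from Finset.ext fun x => by revert x; decide,
    hamCount_eq_length_hamPathsList graph adj (vsPair 25 27) (by decide) (fun _ _ _ _ => Iff.rfl)]
  decide +kernel

/-- **The diamond ladder is exclusive**: every family of port-to-port strands covering it pairs
`24` with `25` and `26` with `27` ("one has to enter and exit on the same vertical axis", now with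
free diamonds on the rungs). [cite: LiskiewiczOgiharaToda2003, §3 (XOR-gadget), Fig. 2 (b)] -/
theorem exclusive : Exclusive graph VX slots := by
  rw [slots]
  refine exclusive_pair_of_hamCount_eq_zero (e := se) (f := sf)
    (by decide) (by decide) (by decide) (by decide) (by decide) (by decide) (by decide) (by decide) (by decide) (by decide)
    hamCount_24_26 hamCount_24_27 hamCount_25_26 hamCount_25_27 (W := Finset.univ) mem_univ_iff_ports ?_ ?_
  · -- connector `26 25`, from `24` to `27`
    show hamCount (graph ⊔ _root_.SimpleGraph.fromEdgeSet {s((26 : Fin 28), (25 : Fin 28))}) Finset.univ 24 27 = 0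
    rw [fromEdgeSet_pair_comm]; exact hamCount_connA
  · show hamCount (graph ⊔ _root_.SimpleGraph.fromEdgeSet {s((27 : Fin 28), (25 : Fin 28))}) Finset.univ 24 26 = 0
    rw [fromEdgeSet_pair_comm]; exact hamCount_connB

/-! ### The refined census: the diamonds seen through their hop edges -/

/-- The refined census predicate on a path depends only on the hop edges' membership in `RX`
(for `RX ⊆ H`, `FX = H \ RX`). [folklore] -/
theorem rf_pred_iff {RX : Finset (Fin 28 × Fin 28)} (hRX : RX ⊆ H) (l : List (Fin 28)) :
    ((∀ x ∈ RX, Uses l x) ∧ ∀ x ∈ H \ RX, ¬ Uses l x) ↔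
      ∀ k : Fin 4, (Uses l (UL k) ↔ UL k ∈ RX) ∧ (Uses l (LL k) ↔ LL k ∈ RX) := by
  constructor
  · rintro ⟨hR, hF⟩ k
    have hUL : UL k ∈ H := mem_H_iff.2 ⟨k, Or.inl rfl⟩
    have hLL : LL k ∈ H := mem_H_iff.2 ⟨k, Or.inr rfl⟩
    refine ⟨⟨fun hu => ?_, fun hm => hR _ hm⟩, ⟨fun hu => ?_, fun hm => hR _ hm⟩⟩
    · by_contra hm; exact hF _ (Finset.mem_sdiff.2 ⟨hUL, hm⟩) hu
    · by_contra hm; exact hF _ (Finset.mem_sdiff.2 ⟨hLL, hm⟩) hu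
  · intro h
    refine ⟨fun x hx => ?_, fun x hx hu => ?_⟩
    · obtain ⟨k, rfl | rfl⟩ := mem_H_iff.1 (hRX hx)
      exacts [(h k).1.2 hx, (h k).2.2 hx]
    · obtain ⟨hxH, hxR⟩ := Finset.mem_sdiff.1 hx
      obtain ⟨k, rfl | rfl⟩ := mem_H_iff.1 hxH
      exacts [hxR ((h k).1.1 hu), hxR ((h k).2.1 hu)]

/-- The eight membership bits of a set of hop edges: bit `k` for `UL k`, bit `k + 4` for `LL k`. [folklore] -/
def bitsOf (RX : Finset (Fin 28 × Fin 28)) (i : Fin 8) : Bool :=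
  if h : i.val < 4 then decide (UL ⟨i.val, h⟩ ∈ RX) else decide (LL ⟨i.val - 4, by omega⟩ ∈ RX)

/-- Reading the bits back: `UL`. [folklore] -/
theorem bits_spec {RX : Finset (Fin 28 × Fin 28)} {n : ℕ} (hU : RailGadget.bitsU 8 n = bitsOf RX) (k : Fin 4) :
    (n.testBit k.val = true ↔ UL k ∈ RX) ∧ (n.testBit (k.val + 4) = true ↔ LL k ∈ RX) := by
  have h1 := congrFun hU ⟨k.val, by omega⟩
  have h2 := congrFun hU ⟨k.val + 4, by omega⟩
  simp only [RailGadget.bitsU, bitsOf, k.isLt, dif_pos] at h1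
  simp only [RailGadget.bitsU, bitsOf, show ¬ (k.val + 4 < 4) by omega, dif_neg, not_false_eq_true,
    Nat.add_sub_cancel] at h2
  rw [h1, h2, decide_eq_true_iff, decide_eq_true_iff]
  exact ⟨Iff.rfl, Iff.rfl⟩

/-- Consistency read off the bits. [folklore] -/
theorem consistent_iff_bits {RX : Finset (Fin 28 × Fin 28)} {n : ℕ} (hU : RailGadget.bitsU 8 n = bitsOf RX) :
    Consistent RX ↔ ∀ k : Fin 4, n.testBit k.val ≠ n.testBit (k.val + 4) := by
  unfold Consistent
  refine forall_congr' fun k => ?_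
  obtain ⟨h1, h2⟩ := bits_spec hU k
  rw [← h1, ← h2]
  cases n.testBit k.val <;> cases n.testBit (k.val + 4) <;> simp

/-- **The refined census table, `e` side** (kernel computation over the 256 patterns of required hop
edges, as bits): exactly one traversal from the `e` side iff each diamond has exactly one of its two
hop edges required, none otherwise. [cite: LiskiewiczOgiharaToda2003, §3, Fig. 2 (b)] -/
theorem table_e : ∀ n < 2 ^ 8,
    ((hamPathsList adj vsE 24 25).filter fun l =>
        decide (∀ k : Fin 4, (Uses l (UL k) ↔ n.testBit k.val = true) ∧ (Uses l (LL k) ↔ n.testBit (k.val + 4) = true))).length =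
      if (∀ k : Fin 4, n.testBit k.val ≠ n.testBit (k.val + 4)) then 1 else 0 := by
  rw [hamPathsList_e]
  decide +kernel

/-- **The refined census table, `f` side.** [cite: LiskiewiczOgiharaToda2003, §3, Fig. 2 (b)] -/
theorem table_f : ∀ n < 2 ^ 8,
    ((hamPathsList adj vsF 26 27).filter fun l =>
        decide (∀ k : Fin 4, (Uses l (UL k) ↔ n.testBit k.val = true) ∧ (Uses l (LL k) ↔ n.testBit (k.val + 4) = true))).length =
      if (∀ k : Fin 4, n.testBit k.val ≠ n.testBit (k.val + 4)) then 1 else 0 := by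
  rw [hamPathsList_f]
  decide +kernel

/-- The refined predicate through the bits. [folklore] -/
theorem rf_pred_iff_bits {RX : Finset (Fin 28 × Fin 28)} (hRX : RX ⊆ H) {n : ℕ} (hU : RailGadget.bitsU 8 n = bitsOf RX)
    (l : List (Fin 28)) :
    ((∀ x ∈ RX, Uses l x) ∧ ∀ x ∈ H \ RX, ¬ Uses l x) ↔
      ∀ k : Fin 4, (Uses l (UL k) ↔ n.testBit k.val = true) ∧ (Uses l (LL k) ↔ n.testBit (k.val + 4) = true) := by
  rw [rf_pred_iff hRX]
  refine forall_congr' fun k => ?_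
  obtain ⟨h1, h2⟩ := bits_spec hU k
  rw [h1, h2]

/-- **Refined census `N({e}; RX, H \ RX) = [RX consistent]`.** [cite: LiskiewiczOgiharaToda2003, §3, Fig. 2 (b)] -/
theorem coverCountRF_e {RX : Finset (Fin 28 × Fin 28)} (hRX : RX ⊆ H) :
    coverCountRF graph VX {se} RX (H \ RX) = if Consistent RX then 1 else 0 := by
  obtain ⟨n, hn, hU⟩ := RailGadget.exists_bitsU (bitsOf RX)
  have hFX : H \ RX ⊆ H := Finset.sdiff_subset
  rw [se, coverCountRF_singleton_eq_hamCountRF VX_nonempty (by decide) (by decide) (by decide)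
    (fun x hx => H_inner x (hRX hx)) (fun x hx => H_inner x (hFX hx)), ← toFinset_vsE,
    hamCountRF_eq_length_filter graph adj vsE nodup_vsE (fun _ _ _ _ => Iff.rfl),
    if_congr (consistent_iff_bits hU) rfl rfl, ← table_e n hn]
  congr 1
  exact List.filter_congr fun l _ => decide_eq_decide.mpr (rf_pred_iff_bits hRX hU l)

/-- **Refined census `N({f}; RX, H \ RX) = [RX consistent]`.** [cite: LiskiewiczOgiharaToda2003, §3, Fig. 2 (b)] -/
theorem coverCountRF_f {RX : Finset (Fin 28 × Fin 28)} (hRX : RX ⊆ H) :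
    coverCountRF graph VX {sf} RX (H \ RX) = if Consistent RX then 1 else 0 := by
  obtain ⟨n, hn, hU⟩ := RailGadget.exists_bitsU (bitsOf RX)
  have hFX : H \ RX ⊆ H := Finset.sdiff_subset
  rw [sf, coverCountRF_singleton_eq_hamCountRF VX_nonempty (by decide) (by decide) (by decide)
    (fun x hx => H_inner x (hRX hx)) (fun x hx => H_inner x (hFX hx)), ← toFinset_vsF,
    hamCountRF_eq_length_filter graph adj vsF nodup_vsF (fun _ _ _ _ => Iff.rfl),
    if_congr (consistent_iff_bits hU) rfl rfl, ← table_f n hn]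
  congr 1
  exact List.filter_congr fun l _ => decide_eq_decide.mpr (rf_pred_iff_bits hRX hU l)

/-- Refined census of both slots and of no slot: zero. [folklore] -/
theorem coverCountRF_ef (RX FX : Finset (Fin 28 × Fin 28)) : coverCountRF graph VX slots RX FX = 0 :=
  Nat.eq_zero_of_le_zero ((coverCountRF_le_coverCount _ _ _ _ _).trans coverCount_ef.le)

/-- Refined census of no slot: zero. [folklore] -/
theorem coverCountRF_none (RX FX : Finset (Fin 28 × Fin 28)) : coverCountRF graph VX ∅ RX FX = 0 :=
  Nat.eq_zero_of_le_zero ((coverCountRF_le_coverCount _ _ _ _ _).trans coverCount_none.le)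

/-! ### Template facts used by placements (by `decide`) -/

/-- Every edge of the template has an inner end (no edge between two ports). [folklore] -/
theorem adj_inner_or : ∀ x y : Fin 28, adj x y = true → x.val < 24 ∨ y.val < 24 := by
  decide

/-- A port has a single neighbour. [folklore] -/
theorem adj_port_unique : ∀ p x y : Fin 28, 24 ≤ p.val → adj p x = true → adj p y = true → x = y := by
  decide

/-- Membership in `VX`. [folklore] -/
theorem mem_VX_iff {x : Fin 28} : x ∈ VX ↔ x.val < 24 := by
  simp [VX]

/-- The ports of the two slots. [folklore] -/
theorem mem_ports_slots_iff {x : Fin 28} : x ∈ ports slots ↔ 24 ≤ x.val := by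
  rw [slots, mem_ports_pair, se, sf]
  simp only
  constructor
  · rintro (rfl | rfl | rfl | rfl) <;> decide
  · intro h
    have : x.val = 24 ∨ x.val = 25 ∨ x.val = 26 ∨ x.val = 27 := by have := x.isLt; omega
    rcases this with h | h | h | h
    · exact Or.inl (Fin.ext h)
    · exact Or.inr (Or.inl (Fin.ext h))
    · exact Or.inr (Or.inr (Or.inl (Fin.ext h)))
    · exact Or.inr (Or.inr (Or.inr (Fin.ext h)))

end DiamondLadder

/-! ### Transport of the refined census along an embedding -/

section transportRF

variable {τ β : Type*} [DecidableEq τ] [DecidableEq β] (φ : τ ↪ β)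
  {G : _root_.SimpleGraph τ} {VXτ : Finset τ} {U RX FX : Finset (τ × τ)}

omit [DecidableEq τ] [DecidableEq β] in
/-- Strand usage is invariant under the push-forward. [folklore] -/
theorem usesF_pushFamily_iff (f : τ × τ → List τ) (x : τ × τ) :
    UsesF (pushFamily φ f) (U.map (φ.prodMap φ)) (φ x.1, φ x.2) ↔ UsesF f U x := by
  constructor
  · rintro ⟨e', he', hu⟩
    obtain ⟨e, he, rfl⟩ := exists_eq_of_mem_map_prodMap φ he'
    rw [pushFamily_apply] at hu
    exact ⟨e, he, (uses_map_iff φ.injective).1 hu⟩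
  · rintro ⟨e, he, hu⟩
    exact ⟨(φ e.1, φ e.2), (mem_map_prodMap_iff φ).2 he, by rw [pushFamily_apply]; exact (uses_map_iff φ.injective).2 hu⟩

omit [DecidableEq τ] [DecidableEq β] in
/-- **The refined census is invariant under the embedding.** [cite: GareyJohnson1979, §3.2.2] -/
theorem coverCountRF_map :
    coverCountRF (G.map φ) (VXτ.map φ) (U.map (φ.prodMap φ)) (RX.map (φ.prodMap φ)) (FX.map (φ.prodMap φ)) =
      coverCountRF G VXτ U RX FX := by
  have himage : coverSetRF (G.map φ) (VXτ.map φ) (U.map (φ.prodMap φ)) (RX.map (φ.prodMap φ)) (FX.map (φ.prodMap φ)) =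
      pushFamily φ '' coverSetRF G VXτ U RX FX := by
    ext f'
    constructor
    · rintro ⟨hf', hR, hF⟩
      obtain ⟨f, hf, rfl⟩ := exists_eq_pushFamily_of_isCover φ hf'
      refine ⟨f, ⟨hf, fun x hx => ?_, fun x hx hu => ?_⟩, rfl⟩
      · exact (usesF_pushFamily_iff φ f x).1 (hR _ ((mem_map_prodMap_iff φ).2 hx))
      · exact hF _ ((mem_map_prodMap_iff φ).2 hx) ((usesF_pushFamily_iff φ f x).2 hu)
    · rintro ⟨f, ⟨hf, hR, hF⟩, rfl⟩
      refine ⟨isCover_pushFamily φ hf, fun x' hx' => ?_, fun x' hx' hu => ?_⟩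
      · obtain ⟨x, hx, rfl⟩ := exists_eq_of_mem_map_prodMap φ hx'
        exact (usesF_pushFamily_iff φ f x).2 (hR x hx)
      · obtain ⟨x, hx, rfl⟩ := exists_eq_of_mem_map_prodMap φ hx'
        exact hF x hx ((usesF_pushFamily_iff φ f x).1 hu)
  have hinj : Set.InjOn (pushFamily φ) (coverSetRF G VXτ U RX FX) :=
    (pushFamily_injOn φ).mono (coverSetRF_subset G VXτ U RX FX)
  rw [coverCountRF, coverCountRF, himage, hinj.ncard_image]

end transportRF

/-! ### Placements of the diamond ladder on numbered vertices -/

/-- **A placement of the diamond ladder**: the first number of its block of 24 inner vertices and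
the numbered ports `eT ~ v₀`, `eF ~ v₃`, `fT ~ w₀`, `fF ~ w₃` (the ends of the two slot edges it is
substituted for), below the block and pairwise distinct. [cite: GareyJohnson1979, §3.2.2 (local replacement by a copy)] -/
structure DLPlacement where
  /-- first numbered inner vertex -/
  base : ℕ
  /-- the end of slot `e` attached to `v₀` -/
  eT : ℕ
  /-- the end of slot `e` attached to `v₃` -/
  eF : ℕ
  /-- the end of slot `f` attached to `w₀` -/
  fT : ℕ
  /-- the end of slot `f` attached to `w₃` -/
  fF : ℕ
  eT_lt : eT < base
  eF_lt : eF < base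
  fT_lt : fT < base
  fF_lt : fF < base
  hne12 : eT ≠ eF
  hne13 : eT ≠ fT
  hne14 : eT ≠ fF
  hne23 : eF ≠ fT
  hne24 : eF ≠ fF
  hne34 : fT ≠ fF

namespace DLPlacement

variable (P : DLPlacement)

/-- The numbering of the template's vertices. [folklore] -/
def embFun (x : Fin 28) : ℕ :=
  if x.val < 24 then P.base + x.val
  else if x.val = 24 then P.eT else if x.val = 25 then P.eF else if x.val = 26 then P.fT else P.fF

/-- Inner vertices are numbered in the block. [folklore] -/
theorem embFun_of_lt {x : Fin 28} (hx : x.val < 24) : P.embFun x = P.base + x.val := by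
  simp [embFun, hx]

/-- The ports' numbers are below the block. [folklore] -/
theorem embFun_lt_base_of_ge {x : Fin 28} (hx : 24 ≤ x.val) : P.embFun x < P.base := by
  have h := P.eT_lt; have := P.eF_lt; have := P.fT_lt; have := P.fF_lt
  unfold embFun
  split_ifs <;> omega

/-- The numbering is injective. [folklore] -/
theorem embFun_injective : Function.Injective P.embFun := by
  intro x y h
  by_cases hx : x.val < 24 <;> by_cases hy : y.val < 24
  · rw [P.embFun_of_lt hx, P.embFun_of_lt hy] at h
    exact Fin.ext (by omega)
  · have := P.embFun_lt_base_of_ge (x := y) (by omega)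
    rw [P.embFun_of_lt hx] at h; omega
  · have := P.embFun_lt_base_of_ge (x := x) (by omega)
    rw [P.embFun_of_lt hy] at h; omega
  · have h1 := P.hne12; have h2 := P.hne13; have h3 := P.hne14; have h4 := P.hne23; have h5 := P.hne24
    have h6 := P.hne34
    have hx' : x.val = 24 ∨ x.val = 25 ∨ x.val = 26 ∨ x.val = 27 := by have := x.isLt; omega
    have hy' : y.val = 24 ∨ y.val = 25 ∨ y.val = 26 ∨ y.val = 27 := by have := y.isLt; omega
    unfold embFun at h
    rw [if_neg hx, if_neg hy] at h
    apply Fin.ext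
    rcases hx' with hx' | hx' | hx' | hx' <;> rcases hy' with hy' | hy' | hy' | hy' <;>
      simp [hx', hy'] at h ⊢ <;> omega

/-- **The embedding of the template.** [folklore] -/
def emb : Fin 28 ↪ ℕ :=
  ⟨P.embFun, P.embFun_injective⟩

/-- The embedding is the numbering. [folklore] -/
@[simp] theorem emb_apply (x : Fin 28) : P.emb x = P.embFun x := rfl

/-- **The placed gadget graph.** [folklore] -/
def GX : _root_.SimpleGraph ℕ :=
  DiamondLadder.graph.map P.emb

/-- **The placed gadget vertices.** [folklore] -/
def VX : Finset ℕ :=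
  DiamondLadder.VX.map P.emb

/-- **The placed slots.** [folklore] -/
def S : Finset (ℕ × ℕ) :=
  DiamondLadder.slots.map (P.emb.prodMap P.emb)

/-- The placed slot `e`. [folklore] -/
def se : ℕ × ℕ := (P.eT, P.eF)

/-- The placed slot `f`. [folklore] -/
def sf : ℕ × ℕ := (P.fT, P.fF)

/-- The placed hop edge `UL k = (base + 8 + 4k, base + 9 + 4k)`. [folklore] -/
def UL (k : Fin 4) : ℕ × ℕ := (P.base + (8 + 4 * k.val), P.base + (9 + 4 * k.val))

/-- The placed hop edge `LL k = (base + 8 + 4k, base + 10 + 4k)`. [folklore] -/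
def LL (k : Fin 4) : ℕ × ℕ := (P.base + (8 + 4 * k.val), P.base + (10 + 4 * k.val))

/-- All eight placed hop edges. [folklore] -/
def H : Finset (ℕ × ℕ) := DiamondLadder.H.map (P.emb.prodMap P.emb)

/-- Consistency of a set of required placed hop edges. [folklore] -/
def Consistent (RX : Finset (ℕ × ℕ)) : Prop :=
  ∀ k : Fin 4, P.UL k ∈ RX ↔ P.LL k ∉ RX

/-- Consistency is decidable. [folklore] -/
instance (RX : Finset (ℕ × ℕ)) : Decidable (P.Consistent RX) := by
  unfold Consistent; infer_instance

/-- The placed slot `e` is the image of the template's. [folklore] -/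
theorem map_se : (P.emb.prodMap P.emb) DiamondLadder.se = P.se := by
  simp [DiamondLadder.se, se, Function.Embedding.prodMap, embFun]

/-- The placed slot `f` is the image of the template's. [folklore] -/
theorem map_sf : (P.emb.prodMap P.emb) DiamondLadder.sf = P.sf := by
  simp [DiamondLadder.sf, sf, Function.Embedding.prodMap, embFun]

/-- The placed hop edges are the images of the template's. [folklore] -/
theorem map_UL (k : Fin 4) : (P.emb.prodMap P.emb) (DiamondLadder.UL k) = P.UL k := by
  have h1 : 8 + 4 * k.val < 24 := by have := k.isLt; omega
  have h2 : 9 + 4 * k.val < 24 := by have := k.isLt; omega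
  simp only [Function.Embedding.prodMap, DiamondLadder.UL, UL, Function.Embedding.coeFn_mk, Prod.map_apply, emb_apply]
  rw [P.embFun_of_lt (by exact h1), P.embFun_of_lt (by exact h2)]

/-- The placed hop edges are the images of the template's. [folklore] -/
theorem map_LL (k : Fin 4) : (P.emb.prodMap P.emb) (DiamondLadder.LL k) = P.LL k := by
  have h1 : 8 + 4 * k.val < 24 := by have := k.isLt; omega
  have h2 : 10 + 4 * k.val < 24 := by have := k.isLt; omega
  simp only [Function.Embedding.prodMap, DiamondLadder.LL, LL, Function.Embedding.coeFn_mk, Prod.map_apply, emb_apply]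
  rw [P.embFun_of_lt (by exact h1), P.embFun_of_lt (by exact h2)]

/-- The placed slots, explicitly. [folklore] -/
theorem S_eq : P.S = {P.se, P.sf} := by
  rw [S, DiamondLadder.slots, Finset.map_insert, Finset.map_singleton, map_se, map_sf]

/-- Membership in the placed hop edges. [folklore] -/
theorem mem_H_iff {x : ℕ × ℕ} : x ∈ P.H ↔ ∃ k, x = P.UL k ∨ x = P.LL k := by
  rw [H, Finset.mem_map]
  constructor
  · rintro ⟨y, hy, rfl⟩
    obtain ⟨k, rfl | rfl⟩ := DiamondLadder.mem_H_iff.1 hy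
    exacts [⟨k, Or.inl (P.map_UL k)⟩, ⟨k, Or.inr (P.map_LL k)⟩]
  · rintro ⟨k, rfl | rfl⟩
    · exact ⟨_, DiamondLadder.mem_H_iff.2 ⟨k, Or.inl rfl⟩, P.map_UL k⟩
    · exact ⟨_, DiamondLadder.mem_H_iff.2 ⟨k, Or.inr rfl⟩, P.map_LL k⟩

/-- **Placed gadget vertices are the block `base, …, base + 23`.** [folklore] -/
theorem mem_VX_iff {v : ℕ} : v ∈ P.VX ↔ P.base ≤ v ∧ v < P.base + 24 := by
  rw [VX, Finset.mem_map]
  constructor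
  · rintro ⟨x, hx, rfl⟩
    rw [DiamondLadder.mem_VX_iff] at hx
    rw [emb_apply, P.embFun_of_lt hx]
    omega
  · rintro ⟨h1, h2⟩
    refine ⟨⟨v - P.base, by omega⟩, DiamondLadder.mem_VX_iff.2 (by simp; omega), ?_⟩
    rw [emb_apply, P.embFun_of_lt (by simp; omega)]
    simp; omega

/-- Ports of the placed slots. [folklore] -/
theorem mem_ports_S_iff {v : ℕ} : v ∈ ports P.S ↔ v = P.eT ∨ v = P.eF ∨ v = P.fT ∨ v = P.fF := by
  rw [S_eq, mem_ports_pair]; rfl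

/-- Images of inner vertices are placed gadget vertices. [folklore] -/
theorem emb_mem_VX {x : Fin 28} (hx : x.val < 24) : P.emb x ∈ P.VX :=
  Finset.mem_map_of_mem _ (DiamondLadder.mem_VX_iff.2 hx)

/-- Images of ports are ports of the placed slots. [folklore] -/
theorem emb_mem_ports {x : Fin 28} (hx : 24 ≤ x.val) : P.emb x ∈ ports P.S := by
  rw [S, ports_map]
  exact Finset.mem_map_of_mem _ (DiamondLadder.mem_ports_slots_iff.2 hx)

/-- **Placed gadget edges attach to ports only.** [folklore] -/
theorem gadget_adj (a b : ℕ) (h : P.GX.Adj a b) :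
    (a ∈ P.VX ∨ b ∈ P.VX) ∧ (a ∈ P.VX ∨ a ∈ ports P.S) ∧ (b ∈ P.VX ∨ b ∈ ports P.S) := by
  obtain ⟨⟨a', rfl⟩, ⟨b', rfl⟩⟩ := exists_eq_of_map_adj P.emb h
  have h' : DiamondLadder.adj a' b' = true := (map_adj_iff P.emb).1 h
  have hor : ∀ x : Fin 28, P.emb x ∈ P.VX ∨ P.emb x ∈ ports P.S := fun x => by
    by_cases hx : x.val < 24
    · exact Or.inl (P.emb_mem_VX hx)
    · exact Or.inr (P.emb_mem_ports (by omega))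
  refine ⟨?_, hor a', hor b'⟩
  rcases DiamondLadder.adj_inner_or a' b' h' with ha | hb
  · exact Or.inl (P.emb_mem_VX ha)
  · exact Or.inr (P.emb_mem_VX hb)

/-- **One port edge at each placed port.** [folklore] -/
theorem port_unique (p : ℕ) (hp : p ∈ ports P.S) (x y : ℕ) (hx : P.GX.Adj p x) (hy : P.GX.Adj p y) : x = y := by
  obtain ⟨p', hp', rfl⟩ := exists_eq_of_mem_ports_map P.emb (by rwa [S] at hp)
  have hp'' : 24 ≤ p'.val := DiamondLadder.mem_ports_slots_iff.1 hp'
  obtain ⟨-, ⟨x', rfl⟩⟩ := exists_eq_of_map_adj P.emb hx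
  obtain ⟨-, ⟨y', rfl⟩⟩ := exists_eq_of_map_adj P.emb hy
  rw [DiamondLadder.adj_port_unique p' x' y' hp'' ((map_adj_iff P.emb).1 hx) ((map_adj_iff P.emb).1 hy)]

/-- **A placed diamond ladder is exclusive.** [cite: LiskiewiczOgiharaToda2003, §3 (XOR-gadget), Fig. 2 (b)] -/
theorem exclusive : Exclusive P.GX P.VX P.S :=
  DiamondLadder.exclusive.map P.emb

/-- A subset of an embedded image is an embedded image. [folklore] -/
theorem exists_eq_map_of_subset_map {γ δ : Type*} [DecidableEq δ] {f : γ ↪ δ} {s : Finset γ} {t : Finset δ}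
    (h : t ⊆ s.map f) : ∃ u ⊆ s, t = u.map f := by
  rw [Finset.map_eq_image] at h
  obtain ⟨u, hu, rfl⟩ := Finset.subset_image_iff.1 h
  exact ⟨u, hu, (Finset.map_eq_image f u).symm⟩

/-- The four subsets of the template's slots. [folklore] -/
theorem subset_slots_cases {U₀ : Finset (Fin 28 × Fin 28)} (h : U₀ ⊆ DiamondLadder.slots) :
    U₀ = ∅ ∨ U₀ = {DiamondLadder.se} ∨ U₀ = {DiamondLadder.sf} ∨ U₀ = DiamondLadder.slots := by
  have hmem : ∀ x ∈ U₀, x = DiamondLadder.se ∨ x = DiamondLadder.sf := fun x hx => by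
    simpa [DiamondLadder.slots] using h hx
  by_cases h1 : DiamondLadder.se ∈ U₀ <;> by_cases h2 : DiamondLadder.sf ∈ U₀
  · refine Or.inr (Or.inr (Or.inr ?_))
    ext x; simp only [DiamondLadder.slots, Finset.mem_insert, Finset.mem_singleton]
    exact ⟨hmem x, by rintro (rfl | rfl) <;> assumption⟩
  · refine Or.inr (Or.inl ?_)
    ext x; simp only [Finset.mem_singleton]
    refine ⟨fun hx => ?_, by rintro rfl; exact h1⟩
    rcases hmem x hx with rfl | rfl
    · rfl
    · exact absurd hx h2
  · refine Or.inr (Or.inr (Or.inl ?_))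
    ext x; simp only [Finset.mem_singleton]
    refine ⟨fun hx => ?_, by rintro rfl; exact h2⟩
    rcases hmem x hx with rfl | rfl
    · exact absurd hx h1
    · rfl
  · refine Or.inl ?_
    ext x; simp only [Finset.notMem_empty, iff_false]
    intro hx
    rcases hmem x hx with rfl | rfl
    exacts [h1 hx, h2 hx]

/-- `se ≠ sf` in the template. [folklore] -/
theorem se_ne_sf : DiamondLadder.se ≠ DiamondLadder.sf := by decide

/-- **Census of a placed diamond ladder**: `16` on each single slot, `0` on no slot and on both.
[cite: LiskiewiczOgiharaToda2003, §3, Fig. 2 (b)] -/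
theorem coverCount_eq {U : Finset (ℕ × ℕ)} (hU : U ⊆ P.S) :
    coverCount P.GX P.VX U = if U.card = 1 then 16 else 0 := by
  obtain ⟨U₀, hU₀, rfl⟩ := exists_eq_map_of_subset_map hU
  rw [GX, VX, coverCount_map, Finset.card_map]
  rcases subset_slots_cases hU₀ with rfl | rfl | rfl | rfl
  · rw [DiamondLadder.coverCount_none]; rfl
  · rw [DiamondLadder.coverCount_e]; rfl
  · rw [DiamondLadder.coverCount_f]; rfl
  · rw [DiamondLadder.coverCount_ef, DiamondLadder.slots, Finset.card_insert_of_notMem (by simpa using se_ne_sf)]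
    rfl

/-- Consistency is invariant under the numbering. [folklore] -/
theorem consistent_map_iff (RX₀ : Finset (Fin 28 × Fin 28)) :
    P.Consistent (RX₀.map (P.emb.prodMap P.emb)) ↔ DiamondLadder.Consistent RX₀ := by
  unfold Consistent DiamondLadder.Consistent
  refine forall_congr' fun k => ?_
  rw [← P.map_UL k, ← P.map_LL k, Finset.mem_map' , Finset.mem_map']

/-- **Refined census of a placed diamond ladder**: with every placed hop edge required or
forbidden, `1` on a single slot iff the required hop edges are consistent, `0` otherwise.
[cite: LiskiewiczOgiharaToda2003, §3, Fig. 2 (b)] -/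
theorem coverCountRF_eq {U : Finset (ℕ × ℕ)} (hU : U ⊆ P.S) {RX : Finset (ℕ × ℕ)} (hRX : RX ⊆ P.H) :
    coverCountRF P.GX P.VX U RX (P.H \ RX) = if U.card = 1 ∧ P.Consistent RX then 1 else 0 := by
  obtain ⟨U₀, hU₀, rfl⟩ := exists_eq_map_of_subset_map hU
  obtain ⟨RX₀, hRX₀, rfl⟩ := exists_eq_map_of_subset_map hRX
  rw [H, ← Finset.map_sdiff, GX, VX, coverCountRF_map, Finset.card_map]
  simp only [consistent_map_iff]
  rcases subset_slots_cases hU₀ with rfl | rfl | rfl | rfl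
  · rw [DiamondLadder.coverCountRF_none]; simp
  · rw [DiamondLadder.coverCountRF_e hRX₀]; simp
  · rw [DiamondLadder.coverCountRF_f hRX₀]; simp
  · rw [DiamondLadder.coverCountRF_ef, DiamondLadder.slots, Finset.card_insert_of_notMem (by simpa using se_ne_sf)]
    simp

end DLPlacement

end Literature.Combinatorics.SimpleGraph
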